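import Literature.Barriers.QuantumFields.NoUltralocalGinspargWilson
import Literature.MathematicalPhysics.QuantumLattice.GrassmannIntegralProofs
import Mathlib.Analysis.SpecialFunctions.Complex.Log
import Mathlib.Algebra.Polynomial.Roots
import Mathlib.Order.Interval.Set.Infinite
import HarnessLib

/-!
# No ultralocal Ginsparg–Wilson fermions: the two lemmas of Horváth's proof (proofs only)

First proof companion of `Literature/Barriers/QuantumFields/NoUltralocalGinspargWilson.lean`
(barrier catalogue D-0021, summit `QuantumFields`); the discharge
`NoUltralocalGinspargWilson_holds` of the named fact
`Literature.Barriers.QuantumFields.NoUltralocalGinspargWilson` (Horváth 1998, Theorem "Set `𝒰` is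
empty") is assembled from these lemmas in the sibling `NoUltralocalGinspargWilsonProofs.lean`.
This file declares no definition; everything is a `theorem`, grouped in the dot-namespace
`NoUltralocalGinspargWilson.…` of the fact it serves.

Horváth's printed proof (arXiv:hep-lat/9808002, pp. 3-5) has two ingredients, and this file proves
a formal counterpart of each.

* **Hypercubic symmetry at the diagonal momentum** (proof of the Theorem, step (β), eq. (8):
  `D̄(q) = (1 - Ā)1 + iB̄(γ₁ + γ₂)` at `p = (q, q, 0, 0)`; equation numbers are those of the
  arXiv version, as in the parent file).  The vendored hypothesis (β) quantifies
  the spinor matrix `H` of each reflection / axis exchange existentially, pinned down only by its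
  conjugation action on the `γ_μ`.  We prove Schur's lemma for the tree's explicit chiral-basis
  gamma matrices (`eq_smul_one_of_commute_euclideanGamma`: a `4 × 4` matrix commuting with
  `γ₀, …, γ₃` is scalar — fifteen entries of the four commutators suffice), deduce that `H R` is a
  scalar whenever an explicit matrix `R` obeys the same twisted relations as `H`
  (`mul_eq_smul_one_of_conj`), so that whatever commutes with `H` commutes with `R`
  (`commute_of_mul_eq_smul_one`); we exhibit the three explicit matrices for the reflections of
  the axes `2`, `3` and the exchange `0 ↔ 1` (`reflTwo_rel`, `reflThree_rel`, `swapZeroOne_rel`: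
  `R₂ = -iγ₂γ₅`, `R₃ = γ₃γ₅`, `X = (γ₀ + γ₁)γ₂γ₃/(i - 1)` written out), and read off the row-`0`
  shadow of eq. (8): a matrix commuting with all three has `M₀₁ = M₀₂ = 0`, `M₃₀ = -i M₀₃`
  (`entries_of_commute_spinor`).  With the `(0,0)` entry of the Ginsparg–Wilson relation
  (`gw_entry_zero_zero`) this gives Horváth's eq. (9) `Ā² + 2B̄² = 1` in the form
  `a² + i c² = 1`, `a = 1 - M₀₀`, `c = M₀₃` (assembled in the sibling file).
* **Horváth's Lemma** (arXiv pp. 4-5: trigonometric-polynomial solutions of `𝒜² + d ℬ² = 1` are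
  constant or single-mode), in the factorised form used by Bietenholz 1999: if two trigonometric
  polynomials `f`, `g` satisfy `f g = 1` on `ℝ` then `f(q) = α e^{ikq}` with `k ∈ ℤ`
  (`trigPoly_eq_monomial_of_mul_eq_one`).  "Trigonometric polynomial" is rendered without any new
  definition as "`f(q) e^{iNq} = P(e^{iq})` for some `N : ℕ`, `P : ℂ[X]`"
  (`exists_polynomial_trigSum` puts every finite sum `a₀ + Σ_n e^{iqk(n)} φ(n)`, `k(n) ∈ ℤ`, in
  this form); the proof is `P P' = X^{N+N'}` on the unit circle (infinite:
  `infinite_range_cexp_mul_I`), hence in `ℂ[X]` (`Polynomial.eq_zero_of_infinite_isRoot`), hence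
  `P ∣ X^{N+N'}` is a unit multiple of a power of the prime `X` (`dvd_prime_pow`,
  `Polynomial.isUnit_iff`).

Sources: I. Horváth, Phys. Rev. Lett. 81 (1998) 4063 = hep-lat/9808002, proof of the Theorem and
Lemma (pp. 3-5 of the arXiv version); W. Bietenholz, hep-lat/9901005 (polynomial factorisation);
I. Montvay, G. Münster, *Quantum Fields on a Lattice* (CUP 1994) App. 8.1.2 (the chiral-basis
`γ_μ`, vendored as `Literature.MathematicalPhysics.QuantumLattice.euclideanGamma`, written out in
`GrassmannIntegralProofs.lean`).
-/

noncomputable section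

open Complex Polynomial

namespace Literature.Barriers.QuantumFields

open Literature.MathematicalPhysics.QuantumLattice

namespace NoUltralocalGinspargWilson

/-! ### Schur's lemma for the chiral-basis gamma matrices -/

/-- `γ₀ = i · T₀` with the real signed permutation matrix `T₀` (Montvay–Münster App. 8.1.2 (8.8),
`γ₀ = σʸ ⊗ σˣ` written out in `euclideanGamma_zero`).
[cite: MontvayMunster1994, App. 8.1.2 (8.8)] -/
theorem euclideanGamma_zero_eq_smul :
    euclideanGamma 0 = I • !![0, 0, 0, -1; 0, 0, -1, 0; 0, 1, 0, 0; 1, 0, 0, (0 : ℂ)] := by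
  rw [euclideanGamma_zero]
  ext i j; fin_cases i <;> fin_cases j <;> simp

/-- `γ₂ = i · T₂` with the real signed permutation matrix `T₂` (Montvay–Münster App. 8.1.2 (8.8),
`γ₂ = σʸ ⊗ σᶻ` written out in `euclideanGamma_two`).
[cite: MontvayMunster1994, App. 8.1.2 (8.8)] -/
theorem euclideanGamma_two_eq_smul :
    euclideanGamma 2 = I • !![0, 0, -1, 0; 0, 0, 0, 1; 1, 0, 0, 0; 0, -1, 0, (0 : ℂ)] := by
  rw [euclideanGamma_two]
  ext i j; fin_cases i <;> fin_cases j <;> simp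

/-- **Schur's lemma for the Euclidean gamma matrices.** A complex `4 × 4` matrix commuting with
the four chiral-basis gamma matrices `γ₀, …, γ₃` is a scalar: `Z = Z₀₀ · 1` (the Clifford algebra
on four generators is the full matrix algebra `M₄(ℂ)`, whose centre is `ℂ`).  Proof by fifteen
entries of the four commutation identities for the explicit matrices. [folklore] -/
theorem eq_smul_one_of_commute_euclideanGamma (Z : Matrix (Fin 4) (Fin 4) ℂ)
    (h : ∀ μ, euclideanGamma μ * Z = Z * euclideanGamma μ) :
    Z = Z 0 0 • (1 : Matrix (Fin 4) (Fin 4) ℂ) := by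
  have h0 : !![0, 0, 0, -1; 0, 0, -1, 0; 0, 1, 0, 0; 1, 0, 0, (0 : ℂ)] * Z =
      Z * !![0, 0, 0, -1; 0, 0, -1, 0; 0, 1, 0, 0; 1, 0, 0, (0 : ℂ)] := by
    have := h 0
    rw [euclideanGamma_zero_eq_smul, Matrix.smul_mul, Matrix.mul_smul] at this
    exact smul_right_injective _ I_ne_zero this
  have h2 : !![0, 0, -1, 0; 0, 0, 0, 1; 1, 0, 0, 0; 0, -1, 0, (0 : ℂ)] * Z =
      Z * !![0, 0, -1, 0; 0, 0, 0, 1; 1, 0, 0, 0; 0, -1, 0, (0 : ℂ)] := by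
    have := h 2
    rw [euclideanGamma_two_eq_smul, Matrix.smul_mul, Matrix.mul_smul] at this
    exact smul_right_injective _ I_ne_zero this
  have h1 := h 1
  have h3 := h 3
  rw [euclideanGamma_one] at h1
  rw [euclideanGamma_three] at h3
  have e300 := congrFun (congrFun h3 0) 0
  have e301 := congrFun (congrFun h3 0) 1
  have e302 := congrFun (congrFun h3 0) 2
  have e303 := congrFun (congrFun h3 0) 3
  have e310 := congrFun (congrFun h3 1) 0
  have e311 := congrFun (congrFun h3 1) 1
  have e312 := congrFun (congrFun h3 1) 2
  have e313 := congrFun (congrFun h3 1) 3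
  have e200 := congrFun (congrFun h2 0) 0
  have e203 := congrFun (congrFun h2 0) 3
  have e211 := congrFun (congrFun h2 1) 1
  have e212 := congrFun (congrFun h2 1) 2
  have e100 := congrFun (congrFun h1 0) 0
  have e103 := congrFun (congrFun h1 0) 3
  have e000 := congrFun (congrFun h0 0) 0
  simp [Matrix.mul_apply, Fin.sum_univ_four] at e300 e301 e302 e303 e310 e311 e312 e313
  simp [Matrix.mul_apply, Fin.sum_univ_four] at e200 e203 e211 e212 e100 e103 e000
  have z01 : Z 0 1 = 0 := by linear_combination (-(1 : ℂ) / 2) * e303 - (1 / 2) * e203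
  have z02 : Z 0 2 = 0 := by linear_combination (-(1 : ℂ) / 2) * e300 - (1 / 2) * e200
  have z03 : Z 0 3 = 0 := by linear_combination (-(1 : ℂ) / 2) * e100 - (1 / 2) * e000
  have z10 : Z 1 0 = 0 := by linear_combination ((1 : ℂ) / 2) * e212 - (1 / 2) * e312
  have z13 : Z 1 3 = 0 := by linear_combination ((1 : ℂ) / 2) * e211 - (1 / 2) * e311
  have z20 : Z 2 0 = 0 := by linear_combination e300 + z02
  have z23 : Z 2 3 = 0 := by linear_combination e303 + z01
  have z31 : Z 3 1 = 0 := by linear_combination e311 + z13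
  have z32 : Z 3 2 = 0 := by linear_combination e312 + z10
  have z30 : Z 3 0 = 0 := by linear_combination e100 + z03
  have z12 : Z 1 2 = 0 := by linear_combination -e310 + z30
  have z21 : Z 2 1 = 0 := by linear_combination e301 + z03
  have z11 : Z 1 1 = Z 0 0 := by linear_combination -e313 + e103
  ext i j
  fin_cases i <;> fin_cases j <;>
    simp [z01, z02, z03, z10, z13, z20, z23, z31, z32, z30, z12, z21, z11, e302, e103]

/-! ### Transfer of commutation from the abstract spinor matrix `H` to an explicit one -/

/-- If `H` is invertible and induces on the `γ_μ` the conjugation `H⁻¹ γ_μ H = Γ' μ` (hypothesis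
(β) of Horváth's Definition, arXiv p. 3), and an explicit matrix `R` satisfies the same twisted
relations `Γ' μ · R = R · γ_μ`, then `H R` commutes with every `γ_μ`, hence is a scalar by
`eq_smul_one_of_commute_euclideanGamma`. [folklore] -/
theorem mul_eq_smul_one_of_conj {H R : Matrix (Fin 4) (Fin 4) ℂ}
    (Γ' : Fin 4 → Matrix (Fin 4) (Fin 4) ℂ) (hH : IsUnit H.det)
    (hHγ : ∀ μ, H⁻¹ * euclideanGamma μ * H = Γ' μ)
    (hR : ∀ μ, Γ' μ * R = R * euclideanGamma μ) :
    H * R = (H * R) 0 0 • (1 : Matrix (Fin 4) (Fin 4) ℂ) := by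
  apply eq_smul_one_of_commute_euclideanGamma
  intro μ
  have h1 : euclideanGamma μ * H = H * Γ' μ := by
    rw [← hHγ μ, ← Matrix.mul_assoc, ← Matrix.mul_assoc, Matrix.mul_nonsing_inv _ hH,
      Matrix.one_mul]
  rw [← Matrix.mul_assoc, h1, Matrix.mul_assoc, hR, Matrix.mul_assoc]

/-- If `H` is invertible, `H R = c • 1` and `M` commutes with `H`, then `M` commutes with `R`
(indeed `R = c • H⁻¹`). [folklore] -/
theorem commute_of_mul_eq_smul_one {H R M : Matrix (Fin 4) (Fin 4) ℂ} {c : ℂ}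
    (hH : IsUnit H.det) (hc : H * R = c • (1 : Matrix (Fin 4) (Fin 4) ℂ))
    (hM : M * H = H * M) : M * R = R * M := by
  have hR : R = c • H⁻¹ := by
    calc R = H⁻¹ * (H * R) := by
          rw [← Matrix.mul_assoc, Matrix.nonsing_inv_mul _ hH, Matrix.one_mul]
      _ = c • H⁻¹ := by rw [hc, Matrix.mul_smul, Matrix.mul_one]
  have hM' : M * H⁻¹ = H⁻¹ * M := by
    calc M * H⁻¹ = H⁻¹ * (H * M) * H⁻¹ := by
          rw [← Matrix.mul_assoc, Matrix.nonsing_inv_mul _ hH, Matrix.one_mul]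
      _ = H⁻¹ * (M * H) * H⁻¹ := by rw [hM]
      _ = H⁻¹ * M := by
          rw [Matrix.mul_assoc, Matrix.mul_assoc, Matrix.mul_nonsing_inv _ hH, Matrix.mul_one]
  rw [hR, Matrix.mul_smul, Matrix.smul_mul, hM']

/-! ### The three explicit spinor matrices fixing the diagonal momentum `(q, q, 0, 0)` -/

/-- Twisted commutation relations of `R₂ = -i γ₂ γ₅` (a spinor matrix of the reflection `ℛ₂` of
axis `2`, Horváth's first displayed transformation rule, arXiv p. 3): `γ_μ R₂ = R₂ γ_μ` for
`μ ≠ 2` and `(-γ₂) R₂ = R₂ γ₂`. [cite: Horvath1998, arXiv p. 3, rule for ℛ_ν] -/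
theorem reflTwo_rel (μ : Fin 4) :
    (if μ = 2 then -euclideanGamma μ else euclideanGamma μ) *
        !![0, 0, 1, 0; 0, 0, 0, -1; 1, 0, 0, 0; 0, -1, 0, (0 : ℂ)] =
      !![0, 0, 1, 0; 0, 0, 0, -1; 1, 0, 0, 0; 0, -1, 0, (0 : ℂ)] * euclideanGamma μ := by
  fin_cases μ <;>
    simp only [Fin.reduceFinMk, Fin.reduceEq, ↓reduceIte, Fin.isValue] <;>
    norm_num [euclideanGamma_zero, euclideanGamma_one, euclideanGamma_two, euclideanGamma_three]

/-- Twisted commutation relations of `R₃ = γ₃ γ₅` (a spinor matrix of the reflection `ℛ₃` of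
axis `3`): `γ_μ R₃ = R₃ γ_μ` for `μ ≠ 3` and `(-γ₃) R₃ = R₃ γ₃`.
[cite: Horvath1998, arXiv p. 3, rule for ℛ_ν] -/
theorem reflThree_rel (μ : Fin 4) :
    (if μ = 3 then -euclideanGamma μ else euclideanGamma μ) *
        !![0, 0, -1, 0; 0, 0, 0, -1; 1, 0, 0, 0; 0, 1, 0, (0 : ℂ)] =
      !![0, 0, -1, 0; 0, 0, 0, -1; 1, 0, 0, 0; 0, 1, 0, (0 : ℂ)] * euclideanGamma μ := by
  fin_cases μ <;>
    simp only [Fin.reduceFinMk, Fin.reduceEq, ↓reduceIte, Fin.isValue] <;>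
    norm_num [euclideanGamma_zero, euclideanGamma_one, euclideanGamma_two, euclideanGamma_three]

/-- Twisted commutation relations of `X = (γ₀ + γ₁) γ₂ γ₃ / (i - 1)` (a spinor matrix of the
exchange `𝒳₀₁` of the axes `0` and `1`, Horváth's second displayed rule, arXiv p. 3):
`γ_{π μ} X = X γ_μ` for the transposition `π = (0 1)`.
[cite: Horvath1998, arXiv p. 3, rule for 𝒳_ρσ] -/
theorem swapZeroOne_rel (μ : Fin 4) :
    euclideanGamma (Equiv.swap (0 : Fin 4) 1 μ) *
        !![0, 0, 0, 1; 0, 0, -I, 0; 0, 1, 0, 0; -I, 0, 0, (0 : ℂ)] =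
      !![0, 0, 0, 1; 0, 0, -I, 0; 0, 1, 0, 0; -I, 0, 0, (0 : ℂ)] * euclideanGamma μ := by
  fin_cases μ <;>
    simp only [Fin.reduceFinMk, Fin.isValue, Equiv.swap_apply_def, Fin.reduceEq, ↓reduceIte] <;>
    norm_num [euclideanGamma_zero, euclideanGamma_one, euclideanGamma_two, euclideanGamma_three]

/-- Entries of a matrix commuting with the three explicit spinor matrices `R₂`, `R₃`, `X`:
`M₀₁ = M₀₂ = 0` and `M₃₀ = -i M₀₃` — the row-`0` shadow of Horváth's reduced form (8),
`D̄(q) = (1 - Ā)1 + iB̄(γ₁ + γ₂)` (here `γ₀ + γ₁`), which is all the proof uses.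
[cite: Horvath1998, proof of the Theorem, step (β), eq. (8), arXiv p. 4] -/
theorem entries_of_commute_spinor (M : Matrix (Fin 4) (Fin 4) ℂ)
    (h₂ : M * !![0, 0, 1, 0; 0, 0, 0, -1; 1, 0, 0, 0; 0, -1, 0, (0 : ℂ)] =
      !![0, 0, 1, 0; 0, 0, 0, -1; 1, 0, 0, 0; 0, -1, 0, (0 : ℂ)] * M)
    (h₃ : M * !![0, 0, -1, 0; 0, 0, 0, -1; 1, 0, 0, 0; 0, 1, 0, (0 : ℂ)] =
      !![0, 0, -1, 0; 0, 0, 0, -1; 1, 0, 0, 0; 0, 1, 0, (0 : ℂ)] * M)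
    (hX : M * !![0, 0, 0, 1; 0, 0, -I, 0; 0, 1, 0, 0; -I, 0, 0, (0 : ℂ)] =
      !![0, 0, 0, 1; 0, 0, -I, 0; 0, 1, 0, 0; -I, 0, 0, (0 : ℂ)] * M) :
    M 0 1 = 0 ∧ M 0 2 = 0 ∧ M 3 0 = -I * M 0 3 := by
  have a00 := congrFun (congrFun h₂ 0) 0
  have a03 := congrFun (congrFun h₂ 0) 3
  have b00 := congrFun (congrFun h₃ 0) 0
  have b03 := congrFun (congrFun h₃ 0) 3
  have c00 := congrFun (congrFun hX 0) 0
  simp [Matrix.mul_apply, Fin.sum_univ_four] at a00 a03 b00 b03 c00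
  exact ⟨by linear_combination (-(1 : ℂ) / 2) * a03 + (1 / 2) * b03,
    by linear_combination ((1 : ℂ) / 2) * a00 + (1 / 2) * b00, by linear_combination -c00⟩

/-- The `(0,0)` entry of the Ginsparg–Wilson relation `M γ₅ + γ₅ M = M γ₅ M` (Horváth's eq. (1),
hypothesis (γ)) in the chiral basis, where `γ₅ = diag(1, 1, -1, -1)` (`gammaFive_eq_diagonal`):
`2 M₀₀ = M₀₀² + M₀₁ M₁₀ - M₀₂ M₂₀ - M₀₃ M₃₀`. [cite: Horvath1998, eq. (1) and step (γ), eq. (9)] -/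
theorem gw_entry_zero_zero (M : Matrix (Fin 4) (Fin 4) ℂ)
    (h : M * gammaFive + gammaFive * M = M * gammaFive * M) :
    2 * M 0 0 = M 0 0 * M 0 0 + M 0 1 * M 1 0 - M 0 2 * M 2 0 - M 0 3 * M 3 0 := by
  have e := congrFun (congrFun h 0) 0
  rw [gammaFive_eq_diagonal] at e
  simp [Matrix.mul_apply, Fin.sum_univ_four, Matrix.diagonal] at e
  linear_combination e

/-! ### Trigonometric polynomials: Horváth's Lemma in factorised form -/

/-- The unit circle `{e^{iq} : q ∈ ℝ}` is an infinite subset of `ℂ` (`q ↦ e^{iq}` is injective on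
`(0, 1)`, by `Complex.exp_eq_exp_iff_exists_int`). [folklore] -/
theorem infinite_range_cexp_mul_I : (Set.range fun q : ℝ => cexp (I * q)).Infinite := by
  have hinj : Set.InjOn (fun q : ℝ => cexp (I * q)) (Set.Ioo 0 1) := by
    intro x hx y hy hxy
    obtain ⟨n, hn⟩ := Complex.exp_eq_exp_iff_exists_int.mp hxy
    have h1 : x = y + n * (2 * Real.pi) := by
      have := congrArg Complex.im hn
      simpa using this
    have hn0 : (n : ℝ) = 0 := by
      by_contra h
      have h1' : (1 : ℝ) ≤ |(n : ℝ)| := by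
        rw [← Int.cast_abs]
        exact_mod_cast Int.one_le_abs (by exact_mod_cast h)
      have h2 : |x - y| < 1 := by
        rw [abs_lt]; constructor <;> linarith [hx.1, hx.2, hy.1, hy.2]
      have h3 : |x - y| = |(n : ℝ)| * (2 * Real.pi) := by
        rw [h1, add_sub_cancel_left, abs_mul, abs_of_pos Real.two_pi_pos]
      nlinarith [Real.two_le_pi, abs_nonneg (n : ℝ)]
    rw [hn0, zero_mul, add_zero] at h1
    exact h1
  exact ((Set.infinite_image_iff hinj).mpr (Set.Ioo_infinite zero_lt_one)).mono
    (Set.image_subset_range _ _)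

/-- **Units among trigonometric polynomials are monomials** — the factorised form of Horváth's
Lemma (arXiv pp. 4-5: the solutions of `𝒜(q)² + d ℬ(q)² = 1` among finite Fourier sums are the
constants (a) and the single-mode pairs (b), none with `K ≠ L` (c)), i.e. Bietenholz's
polynomial-factorisation argument: if `f` and `g` are trigonometric polynomials —
`f(q) e^{iNq} = P(e^{iq})`, `g(q) e^{iN'q} = P'(e^{iq})` with `P, P' ∈ ℂ[X]` — and `f g = 1` on
`ℝ`, then `f(q) = α e^{ikq}` for some `α ∈ ℂ`, `k ∈ ℤ`.  Proof: `P P' - X^{N+N'}` vanishes on the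
infinite unit circle, so `P P' = X^{N+N'}` in `ℂ[X]` and `P` is a unit multiple of a power of
the prime `X`. [cite: Horvath1998, Lemma (a)-(c), arXiv pp. 4-5] -/
theorem trigPoly_eq_monomial_of_mul_eq_one {f g : ℝ → ℂ} {N N' : ℕ} {P P' : ℂ[X]}
    (hf : ∀ q : ℝ, f q * cexp (I * q * N) = P.eval (cexp (I * q)))
    (hg : ∀ q : ℝ, g q * cexp (I * q * N') = P'.eval (cexp (I * q)))
    (hfg : ∀ q, f q * g q = 1) :
    ∃ (α : ℂ) (k : ℤ), ∀ q : ℝ, f q = α * cexp (I * q * k) := by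
  -- `P P' = X ^ (N + N')`, first on the unit circle, then in `ℂ[X]`
  have hroot : ∀ q : ℝ, (P * P' - X ^ (N + N')).IsRoot (cexp (I * q)) := by
    intro q
    simp only [IsRoot, eval_sub, eval_mul, eval_pow, eval_X, ← hf, ← hg]
    rw [pow_add, ← Complex.exp_nat_mul, ← Complex.exp_nat_mul, sub_eq_zero]
    calc f q * cexp (I * q * N) * (g q * cexp (I * q * N'))
        = (f q * g q) * (cexp (I * q * N) * cexp (I * q * N')) := by ring
      _ = cexp (N * (I * q)) * cexp (N' * (I * q)) := by
          rw [hfg q, one_mul]; ring_nf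
  have hPP : P * P' = X ^ (N + N') := by
    refine sub_eq_zero.mp (Polynomial.eq_zero_of_infinite_isRoot _ ?_)
    refine infinite_range_cexp_mul_I.mono ?_
    rintro _ ⟨q, rfl⟩
    exact hroot q
  -- hence `P = α X ^ i`
  obtain ⟨i, -, u, hu⟩ := (dvd_prime_pow Polynomial.prime_X _).mp (Dvd.intro _ hPP)
  obtain ⟨α, -, hα⟩ := Polynomial.isUnit_iff.mp (u⁻¹).isUnit
  have hP : P = C α * X ^ i := by
    calc P = P * u * ↑u⁻¹ := by rw [Units.mul_inv_cancel_right]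
      _ = C α * X ^ i := by rw [hu, hα, mul_comm]
  refine ⟨α, (i : ℤ) - N, fun q => ?_⟩
  have h1 := hf q
  rw [hP, eval_mul, eval_C, eval_pow, eval_X, ← Complex.exp_nat_mul] at h1
  calc f q = f q * cexp (I * q * N) * cexp (-(I * q * N)) := by
        rw [mul_assoc, ← Complex.exp_add, add_neg_cancel, Complex.exp_zero, mul_one]
    _ = α * (cexp (i * (I * q)) * cexp (-(I * q * N))) := by rw [h1, mul_assoc]
    _ = α * cexp (I * q * ((i : ℤ) - N : ℤ)) := by
        rw [← Complex.exp_add]; congr 2; push_cast; ring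

/-- A finite trigonometric sum `a₀ + Σ_{n ∈ s} e^{i q k(n)} φ(n)` with integer frequencies `k(n)`
(Horváth's form (4)/(7) of an ultralocal symbol, hypothesis (α)) is a trigonometric polynomial
in the sense of `trigPoly_eq_monomial_of_mul_eq_one`: multiplied by `e^{iNq}`, `N = Σ_n |k(n)|`,
it is a polynomial in `e^{iq}`. [cite: Horvath1998, eqs. (4) and (7), arXiv pp. 3-4] -/
theorem exists_polynomial_trigSum {ι : Type*} (s : Finset ι) (k : ι → ℤ) (φ : ι → ℂ)
    (a₀ : ℂ) :
    ∃ (N : ℕ) (P : ℂ[X]), ∀ q : ℝ,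
      (a₀ + ∑ n ∈ s, cexp (I * q * (k n : ℂ)) * φ n) * cexp (I * q * N) =
        P.eval (cexp (I * q)) := by
  set N : ℕ := ∑ n ∈ s, (k n).natAbs with hNdef
  have hN : ∀ n ∈ s, 0 ≤ k n + (N : ℤ) := fun n hn => by
    have h1 : |k n| ≤ N := by
      rw [hNdef]; push_cast
      exact Finset.single_le_sum (f := fun m => |k m|) (fun _ _ => abs_nonneg _) hn
    linarith [neg_abs_le (k n)]
  refine ⟨N, C a₀ * X ^ N + ∑ n ∈ s, C (φ n) * X ^ (k n + (N : ℤ)).toNat, fun q => ?_⟩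
  rw [eval_add, eval_finsetSum, add_mul, Finset.sum_mul]
  simp only [eval_mul, eval_C, eval_pow, eval_X, ← Complex.exp_nat_mul]
  congr 1
  · ring_nf
  · refine Finset.sum_congr rfl fun n hn => ?_
    have h2 : (((k n + (N : ℤ)).toNat : ℕ) : ℂ) = (k n : ℂ) + (N : ℂ) := by
      have := Int.toNat_of_nonneg (hN n hn)
      exact_mod_cast congrArg (Int.cast (R := ℂ)) this
    rw [h2, mul_right_comm, ← Complex.exp_add, mul_comm]
    congr 2; ring

end NoUltralocalGinspargWilson

end Literature.Barriers.QuantumFields
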